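import Summits.HodgeConjecture.CorCM.Census.QuarticTwistHalfParity

/-!
# The quartic twist `(ℤ/4 × B, (2,0))`, XVII: NO SCREW TYPES — `μ = β − 1` EXACTLY; the complete law of the quartic twist

COR-CM (cell `pub-hodgecm2`), count-neutral kernel combinatorics by the binder seat b09 (gen 32; lane QUARTIC-TWIST), part XVII, sequel of part XVI
(`QuarticTwistHalfParity`, where the functional is built).  Theorems only; no new definition, no `decide` table, no certificate, no named
fact, no geometry, no `sorry`.
HONEST FRAMING: `HC_CM` is NOT proved; nothing here is a headline or a period.

THE MISSING FUNCTIONAL.  For `|B|` even the block parities of part IX see only `β − 2` dimensions of the Hodge lattice `H`; the lane-note numerics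
(`dim H/(I_G H + 2H) = β − 1` for `B = ℤ/2, ℤ/2², ℤ/6, S₃, ℤ/2³`) asked for one more `G`-invariant functional `H → 𝔽₂`, necessarily NOT the
restriction of a `G`-invariant functional on all exponent vectors.  Here it is.  ORIENTATION PARITY (**`exists_parity`**): if `B` has NO screw type
(`(1,t)·ψ ≠ ψ` for all `ψ, t` — iff no element of order divisible by `4`, part XIV), every stabiliser has even first components
(`par_fst_eq_zero_of_noScrew`), so `c(g·r_ω) := g₁ mod 2` is a well-defined `c : Ty → 𝔽₂` with `c((v,t)·s) = c(s) + v`.  HALF-PARITY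
(**`fpar`**): `f_{b₀}(m) = Σ_s [s(b₀) ≡ c(s) (mod 2)]·m(s) mod 2`.  It kills the pairs (`fpar_pairVec`); a Galois translation moves the base
column, `f_{b₀}((v,t)·m) = f_{b₀+t}(m)` (`fpar_transl`); and ON HODGE VECTORS the base column does not matter (**`fpar_eq_of_mem_hodge`**: 
`f_{b₀}(m) − f_{b₁}(m) = Σ_s m(s)[s(b₀) ≢ s(b₁)] = Σ_s m(s)([χ_{0,b₀} ≠ χ_{0,b₁}] + [χ_{1,b₀} ≠ χ_{1,b₁}])(s) ≡ 0`, each summand a halved difference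
of two Pohlmann forms, `sum_mul_dind_eq_zero`).  So `f` is a `G`-invariant functional on `H` killing the pairs, and `f(w_1) = 1` for `|B|` even
(`fpar_Wvec_one`), while `w_1` is invisible to every block parity.  THE LAW (**`card_orb_le_card_add_one_of_noScrew`**): with no screw type, every
family `S ⊆ H` whose Galois translates generate `H` modulo the pairs has `|S| ≥ β − 1` (for `|B|` odd this is part IX, for `|B|` even the
`β − 1` vectors of part IX have independent `(parities, f)`-values).  THE COMPLETE LAW OF THE QUARTIC TWIST (**`quarticTwist_law_noScrew`** with parts
IX, XII, XV): for every finite group `B` with `|B| ≥ 3`, the least number of Galois orbits of HODGE generators of the Hodge lattice of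
`(ℤ/4 × B, (2,0))` modulo divisor classes is `β − 1 − [B has an element of order divisible by 4]`, attained by rank-four faces.  All [folklore].

## References
* [Pohlmann1968] H. Pohlmann, Algebraic cycles on abelian varieties of complex multiplication type, Ann. of Math. 88 (1968), Thm 1.
* [Milne1999] J. S. Milne, Lefschetz motives and the Tate conjecture, Compositio Math. 117 (1999), Prop. 2.1, p. 54.
-/

namespace Summit.HodgeConjecture.CorCM.Census.QuarticTwist

open Finset

variable (B : Type) [AddGroup B] [Fintype B] [DecidableEq B]

/-! ## The law without screw types -/

/-- **THE HODGE-INTRINSIC LAW WITHOUT SCREW TYPES, even case.**  If `B` (`|B|` even `≥ 4`) has no screw type and a finite family `S` of HODGE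
vectors generates the Hodge lattice together with the pairs and all Galois translates, then `β ≤ |S| + 1`. [folklore] -/
theorem card_orb_le_card_add_one_of_noScrew_even (hB : Even (Fintype.card B)) (h3 : 3 ≤ Fintype.card B)
    (hns : ∀ (ψ : Ty B) (t : B), tw B (1, t) ψ ≠ ψ) (S : Finset (Ty B → ℤ)) (hSH : ∀ v ∈ S, v ∈ hodge B)
    (hS : hodge B ≤ pairs B ⊔ Submodule.span ℤ {w : Ty B → ℤ | ∃ g : ZMod 4 × B, ∃ v ∈ S, w = transl B g v}) :
    Fintype.card (Orb B) ≤ S.card + 1 := by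
  classical
  obtain ⟨b₀⟩ : Nonempty B := Fintype.card_pos_iff.mp (by omega)
  obtain ⟨c, hc⟩ := exists_parity B hns
  set T := Submodule.span (ZMod 2) ((S.image (parF B b₀ c) : Finset _) : Set (Option (Orb B) → ZMod 2)) with hT
  have hT' : Module.finrank (ZMod 2) T ≤ S.card := (finrank_span_finset_le_card _).trans Finset.card_image_le
  -- one `Φ`-decreasing square per non-residual block
  have hsq : ∀ ω : Orb B, ∃ pq : (ZMod 2 × B) × (ZMod 2 × B), ¬ IsRes B ω.out →
      (pq.1.2 ≠ pq.2.2 ∧ Phi B (flip B pq.1 ω.out) < Phi B ω.out ∧ Phi B (flip B pq.2 ω.out) < Phi B ω.out ∧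
        Phi B (flip B pq.2 (flip B pq.1 ω.out)) < Phi B ω.out) := by
    intro ω
    by_cases h : IsRes B ω.out
    · exact ⟨((0, b₀), (0, b₀)), fun h' => (h' h).elim⟩
    · obtain ⟨p, q, hpq⟩ := exists_goodSquare B h3 h
      exact ⟨(p, q), fun _ => hpq⟩
  choose pq hpq using hsq
  -- the residual blocks
  set ωc : Orb B := Quotient.mk (orbitRel B) (atom B 0 b₀ 0) with hωc
  set ωp : Orb B := Quotient.mk (orbitRel B) (atom B 0 b₀ 1) with hωp
  set ωm : Orb B := Quotient.mk (orbitRel B) (atom B 0 b₀ (-1)) with hωm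
  set ω2 : Orb B := Quotient.mk (orbitRel B) (atom B 0 b₀ 2) with hω2
  have n10 : ωp ≠ ωc := mk_atom_ne B h3 b₀ (by decide) (by decide)
  have nm0 : ωm ≠ ωc := mk_atom_ne B h3 b₀ (by decide) (by decide)
  have n20 : ω2 ≠ ωc := mk_atom_ne B h3 b₀ (by decide) (by decide)
  have n1m : ωp ≠ ωm := mk_atom_ne B h3 b₀ (by decide) (by decide)
  have n12 : ωp ≠ ω2 := mk_atom_ne B h3 b₀ (by decide) (by decide)
  have nm2 : ωm ≠ ω2 := mk_atom_ne B h3 b₀ (by decide) (by decide)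
  -- the index type and the vectors
  let NRt := {ω : Orb B // ¬ IsRes B ω.out}
  have resb : ∀ (ω : NRt) (k : ZMod 4), (ω.1 : Orb B) ≠ Quotient.mk (orbitRel B) (atom B 0 b₀ k) := by
    intro ω k h
    apply ω.2
    have hrel : (orbitRel B).r ω.1.out (atom B 0 b₀ k) := Quotient.exact (by rw [Quotient.out_eq]; exact h)
    exact (isRes_iff_of_rel B hrel).mpr ⟨0, b₀, k, rfl⟩
  let vec : Option (Option (Option NRt)) → (Ty B → ℤ) := fun x =>
    match x with
    | none => faceVec B (cst B 0) (0, b₀) (1, b₀)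
    | some none => Xvec B 0 b₀
    | some (some none) => Wvec B 1
    | some (some (some ω)) => faceVec B ω.1.out (pq ω.1).1 (pq ω.1).2
  have hvecH : ∀ x, vec x ∈ hodge B := by
    rintro (_ | _ | _ | ω)
    · exact faceVec_mem B _ (fun h => (zero_ne_one (α := ZMod 2)) (congrArg Prod.fst h))
    · exact Xvec_mem B 0 b₀
    · exact Wvec_mem B 1
    · exact faceVec_mem B _ (fun h => (hpq ω.1 ω.2).1 (congrArg Prod.snd h))
  have hmem : ∀ x, parF B b₀ c (vec x) ∈ T := fun x => parF_mem_span_of_mem B hc S hSH (hS (hvecH x))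
  -- values of the three residual parities at the residual blocks, and vanishing at non-residual blocks
  have vcol : ∀ ω : Orb B, parVec B (vec none) ω = (if ω = ωc then 1 else 0) - (if ω = ωp then 1 else 0) - (if ω = ωm then 1 else 0)
      + (if ω = ω2 then 1 else 0) := fun ω => parVec_colface_apply B b₀ ω
  have vX : ∀ ω : Orb B, parVec B (vec (some none)) ω = (if ω = ωp then 1 else 0) + (if ω = ωm then 1 else 0) - (if ω = ωc then 1 else 0)
      - (if ω = ωc then 1 else 0) := fun ω => parVec_Xvec_apply B b₀ ω
  have vW : ∀ ω : Orb B, parVec B (vec (some (some none))) ω = (Fintype.card B : ZMod 2) * (if ω = ωm then 1 else 0)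
      - ((Fintype.card B : ℤ) - 1 : ℤ) • (if ω = ωc then (1 : ZMod 2) else 0) - (if ω = ωc then 1 else 0) :=
    fun ω => parVec_Wvec_apply B b₀ ω
  have fW : fpar B b₀ c (Wvec B 1) = 1 := fpar_Wvec_one B hc hB b₀
  -- linear independence
  have hli : LinearIndependent (ZMod 2) (fun x => parF B b₀ c (vec x)) := by
    rw [Fintype.linearIndependent_iff]
    intro g hsum
    have heval : ∀ ω : Orb B, g none * parVec B (vec none) ω + (g (some none) * parVec B (vec (some none)) ω
        + (g (some (some none)) * parVec B (vec (some (some none))) ω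
          + ∑ ωn : NRt, g (some (some (some ωn))) * parVec B (vec (some (some (some ωn)))) ω)) = 0 := by
      intro ω
      have h := congrFun hsum (some ω)
      rw [Finset.sum_apply, Fintype.sum_option, Fintype.sum_option, Fintype.sum_option] at h
      simpa only [Pi.smul_apply, smul_eq_mul, Finset.sum_apply, Pi.zero_apply, parF_apply_some] using h
    -- (a) the non-residual coefficients vanish
    have hnr : ∀ ωn : NRt, g (some (some (some ωn))) = 0 := by
      by_contra hne
      obtain ⟨ω₁, hω₁⟩ := not_forall.mp hne
      obtain ⟨ω₀, hω₀, hmax⟩ := Finset.exists_max_image (univ.filter fun ωn : NRt => g (some (some (some ωn))) ≠ 0)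
        (fun ωn => Phi B ωn.1.out) ⟨ω₁, mem_filter.mpr ⟨mem_univ _, hω₁⟩⟩
      have hg₀ : g (some (some (some ω₀))) ≠ 0 := (mem_filter.mp hω₀).2
      have hs₀ : ω₀.1.out ∈ orbSet B ω₀.1 := (mem_orbSet B).mpr (Quotient.out_eq _)
      have hω₀Phi : ∀ s' ∈ orbSet B ω₀.1, Phi B ω₀.1.out ≤ Phi B s' := fun s' hs' => (Phi_eq_of_mem_orbSet B hs₀ hs').le
      have h := heval ω₀.1
      rw [vcol, vX, vW, if_neg (resb ω₀ 0), if_neg (resb ω₀ 1), if_neg (resb ω₀ (-1)), if_neg (resb ω₀ 2)] at h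
      have hterm : ∀ ωn : NRt, g (some (some (some ωn))) * parVec B (vec (some (some (some ωn)))) ω₀.1
          = if ωn = ω₀ then g (some (some (some ω₀))) else 0 := by
        intro ωn
        by_cases hgn : g (some (some (some ωn))) = 0
        · rw [hgn, zero_mul]; split_ifs with h' <;> [rw [← h', hgn]; rfl]
        · have hle : Phi B ωn.1.out ≤ Phi B ω₀.1.out := hmax ωn (mem_filter.mpr ⟨mem_univ _, hgn⟩)
          obtain ⟨-, q1, q2, q12⟩ := hpq ωn.1 ωn.2
          have hφ : ∀ s' ∈ orbSet B ω₀.1, Phi B ωn.1.out ≤ Phi B s' := fun s' hs' => hle.trans (hω₀Phi s' hs')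
          rw [show vec (some (some (some ωn))) = faceVec B ωn.1.out (pq ωn.1).1 (pq ωn.1).2 from rfl,
            parVec_goodSquare B q1 q2 q12 ω₀.1 hφ]
          by_cases hωω : ωn = ω₀
          · subst hωω; rw [if_pos hs₀, if_pos rfl, mul_one]
          · have hnot : ωn.1.out ∉ orbSet B ω₀.1 := by
              intro hin
              exact hωω (Subtype.ext (((mem_orbSet B).mp hin).symm ▸ (Quotient.out_eq ωn.1).symm ▸ rfl))
            rw [if_neg hnot, if_neg hωω, mul_zero]
      rw [Finset.sum_congr rfl (fun ωn _ => hterm ωn), Finset.sum_ite_eq' univ ω₀, if_pos (mem_univ _)] at h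
      simp only [mul_zero, smul_zero, sub_self, add_zero, zero_add] at h
      exact hg₀ h
    have hrest : ∀ ω : Orb B, g none * parVec B (vec none) ω + (g (some none) * parVec B (vec (some none)) ω
        + g (some (some none)) * parVec B (vec (some (some none))) ω) = 0 := by
      intro ω
      have h := heval ω
      rw [Finset.sum_eq_zero (fun ωn _ => by rw [hnr ωn, zero_mul]), add_zero] at h
      exact h
    -- (b) evaluate at the blocks of `2δ`, `+δ`, `−δ`
    have e2 : g none = 0 := by
      have h := hrest ω2
      rw [vcol, vX, vW] at h
      simpa [n20, n12.symm, nm2.symm] using h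
    have ep : g (some none) = 0 := by
      have h := hrest ωp
      rw [vcol, vX, vW, e2] at h
      simpa [n10, n1m, n12] using h
    have em : g (some (some none)) = 0 := by
      have h := congrFun hsum none
      rw [Finset.sum_apply, Fintype.sum_option, Fintype.sum_option, Fintype.sum_option] at h
      simp only [Pi.smul_apply, smul_eq_mul, Pi.zero_apply, parF_apply_none, hnr, zero_mul,
        Finset.sum_const_zero, add_zero, e2, ep, zero_add] at h
      rwa [show vec (some (some none)) = Wvec B 1 from rfl, fW, mul_one] at h
    rintro (_ | _ | _ | ω)
    · exact e2
    · exact ep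
    · exact em
    · exact hnr ω
  -- count
  have hli' : LinearIndependent (ZMod 2) (fun x => (⟨_, hmem x⟩ : T)) := LinearIndependent.of_comp T.subtype hli
  have hcard := hli'.fintype_card_le_finrank
  simp only [Fintype.card_option] at hcard
  have hNR : Fintype.card NRt = (univ.filter fun ω : Orb B => ¬ IsRes B ω.out).card := Fintype.card_subtype _
  have hres : (univ.filter fun ω : Orb B => IsRes B ω.out).card ≤ 4 := by
    have hsub : (univ.filter fun ω : Orb B => IsRes B ω.out) ⊆ {ωc, ωp, ωm, ω2} := by
      intro ω hω
      obtain ⟨u, b, k, hk⟩ := (mem_filter.mp hω).2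
      have hω' : ω = Quotient.mk (orbitRel B) (atom B 0 b₀ k) := by rw [← Quotient.out_eq ω, hk, mk_atom_eq B b₀]
      simp only [mem_insert, mem_singleton]
      have key : ∀ k : ZMod 4, k = 0 ∨ k = 1 ∨ k = -1 ∨ k = 2 := by decide
      rcases key k with rfl | rfl | rfl | rfl
      · exact Or.inl hω'
      · exact Or.inr (Or.inl hω')
      · exact Or.inr (Or.inr (Or.inl hω'))
      · exact Or.inr (Or.inr (Or.inr hω'))
    exact (Finset.card_le_card hsub).trans Finset.card_le_four
  have htot := Finset.card_filter_add_card_filter_not (s := (univ : Finset (Orb B))) (fun ω : Orb B => IsRes B ω.out)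
  rw [Finset.card_univ] at htot
  omega

/-- **THE HODGE-INTRINSIC LAW WITHOUT SCREW TYPES** (`|B| ≥ 3`, any parity): `β ≤ |S| + 1` for every generating family `S` of Hodge
vectors. [folklore] -/
theorem card_orb_le_card_add_one_of_noScrew (h3 : 3 ≤ Fintype.card B) (hns : ∀ (ψ : Ty B) (t : B), tw B (1, t) ψ ≠ ψ)
    (S : Finset (Ty B → ℤ)) (hSH : ∀ v ∈ S, v ∈ hodge B)
    (hS : hodge B ≤ pairs B ⊔ Submodule.span ℤ {w : Ty B → ℤ | ∃ g : ZMod 4 × B, ∃ v ∈ S, w = transl B g v}) :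
    Fintype.card (Orb B) ≤ S.card + 1 := by
  rcases Nat.even_or_odd (Fintype.card B) with hev | hodd
  · exact card_orb_le_card_add_one_of_noScrew_even B hev h3 hns S hSH hS
  · exact card_orb_le_card_add_one B hodd h3 S hS

/-- **THE LAW OF THE QUARTIC TWIST WITHOUT ELEMENTS OF ORDER DIVISIBLE BY FOUR** (every finite `B`, `|B| ≥ 3`, `4 ∤ ord t` for all `t`).
(i) `β − 1` rank-four faces (Hodge vectors) generate the Hodge lattice modulo the pairs with their Galois translates, and (ii) no family of fewer
HODGE vectors does: `μ(ℤ/4 × B) = β − 1` EXACTLY.  With part XV: `μ = β − 1 − [∃ t, 4 ∣ ord t]` for every finite `B`. [folklore] -/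
theorem quarticTwist_law_noScrew (h3 : 3 ≤ Fintype.card B) (h4 : ∀ t : B, ¬ 4 ∣ addOrderOf t) :
    (∃ S : Finset (Ty B × (ZMod 2 × B) × (ZMod 2 × B)), (∀ f ∈ S, f.2.1 ≠ f.2.2) ∧ hodge B ≤ pairs B ⊔ spanFaces B S ∧
        S.card + 1 = Fintype.card (Orb B)) ∧
      ∀ S : Finset (Ty B → ℤ), (∀ v ∈ S, v ∈ hodge B) →
        hodge B ≤ pairs B ⊔ Submodule.span ℤ {w : Ty B → ℤ | ∃ g : ZMod 4 × B, ∃ v ∈ S, w = transl B g v} →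
        Fintype.card (Orb B) ≤ S.card + 1 :=
  ⟨exists_faces_generate_all B h3,
    fun S hSH hS => card_orb_le_card_add_one_of_noScrew B h3 (fun _ t hψ => h4 t (four_dvd_of_screw B hψ)) S hSH hS⟩

/-- **THE COMPLETE LAW OF THE QUARTIC TWIST** (every finite group `B`, `|B| ≥ 3`; `δ = [∃ t ∈ B, 4 ∣ ord t]`).  (i) There is a family of
`β − 1 − δ` rank-four faces whose Galois translates generate the Hodge lattice of `(ℤ/4 × B, (2,0))` modulo the pairs; (ii) every family of Hodge
vectors doing so has at least `β − 1 − δ` members: `μ_hodge(ℤ/4 × B) = β − 1 − δ`. [folklore] -/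
theorem quarticTwist_complete_law (h3 : 3 ≤ Fintype.card B) :
    (∃ S : Finset (Ty B × (ZMod 2 × B) × (ZMod 2 × B)), (∀ f ∈ S, f.2.1 ≠ f.2.2) ∧ hodge B ≤ pairs B ⊔ spanFaces B S ∧
        S.card + 1 + (if ∃ t : B, 4 ∣ addOrderOf t then 1 else 0) = Fintype.card (Orb B)) ∧
      ∀ S : Finset (Ty B → ℤ), (∀ v ∈ S, v ∈ hodge B) →
        hodge B ≤ pairs B ⊔ Submodule.span ℤ {w : Ty B → ℤ | ∃ g : ZMod 4 × B, ∃ v ∈ S, w = transl B g v} →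
        Fintype.card (Orb B) ≤ S.card + 1 + (if ∃ t : B, 4 ∣ addOrderOf t then 1 else 0) := by
  by_cases h : ∃ t : B, 4 ∣ addOrderOf t
  · obtain ⟨t, ht⟩ := h
    obtain ⟨h1, h2⟩ := quarticTwist_law_screw B h3 ht
    rw [if_pos ⟨t, ht⟩]
    exact ⟨h1, fun S _ hS => h2 S hS⟩
  · obtain ⟨h1, h2⟩ := quarticTwist_law_noScrew B h3 (fun t ht => h ⟨t, ht⟩)
    rw [if_neg h]
    exact ⟨h1, h2⟩

end Summit.HodgeConjecture.CorCM.Census.QuarticTwist
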